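import Summits.KontsevichZagierPeriods.KontsevichZagierPeriods.Theses.FurushoPentagon
import Literature.NumberTheory.Transcendental.AssociatorsRegularisation
import Literature.NumberTheory.Transcendental.MultipleZetaStar

/-!
# `DoubleShuffleInKZ` (stmt-KontsevichZagierPeriods-14665, route `FurushoPentagon`): the star–stuffle recursion

Helper file (`--supports stmt-KontsevichZagierPeriods-14665`), line "rider lever" for the
Kaneko–Yamamoto integral–series family `IS_j(u)`.  PURE COMBINATORICS (an arbitrary test function
`Z` on indices with values in an additive commutative monoid): the closed form of the series side,

  `G_j(pre, b, suf) = Σ_{c ∈ (1^{j+1})⋆} Σ_{v ∈ suf ∗ c.tail} Z(pre ++ (b + c₁) :: v)`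

(the series `Σ n^{-w} S_j(n_{m+1})` for the word `w = pre ++ (b+1) :: suf`, harmonic-star weight
`S_j(N) = Σ_{N ≥ m₁ ≥ ⋯ ≥ m_j ≥ 1} ∏ 1/mᵢ` attached to block `m = |pre|`: `c₁ − 1` of the `mᵢ` equal
`n_{m+1}`, the other runs `c₂, c₃, …` are placed by the stuffle among the later summation variables),
satisfies the recursion of the rider step (`rider_step`):

  `G_{j+1}(w, m) = Σ_{m ≤ i < k} (G_j(raise_i w, i) + G_j(ins_i w, i + 1))`

(`star_step_identity`; series: `S_{j+1}(N) = Σ_{N' ≤ N} S_j(N')/N'`, the new variable `N'` merging with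
`n_{i+1}` — raise — or falling strictly between `n_{i+1}` and `n_{i+2}` — insert).  Ingredients: the
first-part expansion of `(1ⁿ)⋆` (`MZV.sum_map_starIndices_cons_replicate_one`) and Hoffman's recursion
(A3) (`MZV.sumStuffle_cons_cons`).

References: M. Kaneko, S. Yamamoto, Selecta Math. 24 (2018), §2, Thm 4.1; M. E. Hoffman, J. Algebra
194 (1997), §2.
-/

open scoped BigOperators

namespace Summit.KontsevichZagierPeriods.FurushoPentagon.DoubleShuffleInKZ

open Literature.NumberTheory.Transcendental
open Literature.NumberTheory.Transcendental.MZV (starIndices sumStuffle)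

variable {M : Type*} [AddCommMonoid M] (Z : List ℕ → M)

/-! ### The two sums and their first-letter recursions -/

/-- **First-part split of `G_{j+1}`**: the compositions of `j + 2` with first part `1` give the
"first group" `Σ_{d ∈ (1^{j+1})⋆} Σ_{v ∈ suf ∗ d} Z(pre ++ (b+1) :: v)`, those with first part
`≥ 2` give `G_j(pre, b + 1, suf)`. [cite: KanekoYamamoto2018, §2] -/
theorem starSum_succ (j : ℕ) (pre : List ℕ) (b : ℕ) (suf : List ℕ) :
    ((starIndices (List.replicate (j + 2) 1)).map fun c =>
        sumStuffle (fun v => Z (pre ++ (b + c.headD 0) :: v)) suf c.tail).sum =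
      ((starIndices (List.replicate (j + 1) 1)).map fun c =>
          sumStuffle (fun v => Z (pre ++ (b + 1 + c.headD 0) :: v)) suf c.tail).sum +
        ((starIndices (List.replicate (j + 1) 1)).map fun d =>
          sumStuffle (fun v => Z (pre ++ (b + 1) :: v)) suf d).sum := by
  conv_lhs => rw [List.replicate_succ, MZV.sum_map_starIndices_cons_replicate_one (M := M),
    Finset.sum_range_succ']
  conv_rhs => arg 1; rw [List.replicate_succ, MZV.sum_map_starIndices_cons_replicate_one (M := M)]
  have h1 : ∀ t ∈ Finset.range (j + 1),
      ((starIndices (List.replicate (j + 1 - (t + 1)) 1)).map ((fun c : List ℕ =>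
        sumStuffle (fun v => Z (pre ++ (b + c.headD 0) :: v)) suf c.tail) ∘ List.cons (1 + (t + 1)))).sum =
      ((starIndices (List.replicate (j - t) 1)).map ((fun c : List ℕ =>
        sumStuffle (fun v => Z (pre ++ (b + 1 + c.headD 0) :: v)) suf c.tail) ∘ List.cons (1 + t))).sum := by
    intro t _
    rw [show j + 1 - (t + 1) = j - t by omega]
    refine congrArg List.sum (List.map_congr_left fun d _ => ?_)
    simp only [Function.comp_apply, List.headD_cons, List.tail_cons]
    rw [show b + (1 + (t + 1)) = b + 1 + (1 + t) by omega]
  have h2 : ((starIndices (List.replicate (j + 1 - 0) 1)).map ((fun c : List ℕ =>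
        sumStuffle (fun v => Z (pre ++ (b + c.headD 0) :: v)) suf c.tail) ∘ List.cons (1 + 0))).sum =
      ((starIndices (List.replicate (j + 1) 1)).map fun d =>
          sumStuffle (fun v => Z (pre ++ (b + 1) :: v)) suf d).sum := by
    rw [Nat.sub_zero]
    refine congrArg List.sum (List.map_congr_left fun d _ => ?_)
    simp only [Function.comp_apply, List.headD_cons, List.tail_cons, add_zero]
  rw [Finset.sum_congr rfl h1, h2, add_comm]

/-- **The first group along the suffix** (Hoffman's recursion (A3) in the first letter of the
suffix): for `suf = (a+1) :: suf'`,
`FIRST(pre, b, suf) = FIRST(pre', a, suf') + G_j(pre', 0, suf) + G_j(pre', a + 1, suf')`,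
`pre' = pre ++ [b+1]`. [cite: Hoffman1997, §2 (A3)] -/
theorem firstSum_cons (j : ℕ) (pre : List ℕ) (b a : ℕ) (suf : List ℕ) :
    ((starIndices (List.replicate (j + 1) 1)).map fun d =>
        sumStuffle (fun v => Z (pre ++ (b + 1) :: v)) ((a + 1) :: suf) d).sum =
      ((starIndices (List.replicate (j + 1) 1)).map fun d =>
          sumStuffle (fun v => Z ((pre ++ [b + 1]) ++ (a + 1) :: v)) suf d).sum +
        ((starIndices (List.replicate (j + 1) 1)).map fun c =>
          sumStuffle (fun v => Z ((pre ++ [b + 1]) ++ (0 + c.headD 0) :: v)) ((a + 1) :: suf) c.tail).sum +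
        ((starIndices (List.replicate (j + 1) 1)).map fun c =>
          sumStuffle (fun v => Z ((pre ++ [b + 1]) ++ (a + 1 + c.headD 0) :: v)) suf c.tail).sum := by
  rw [← List.sum_map_add, ← List.sum_map_add]
  refine congrArg List.sum (List.map_congr_left fun d hd => ?_)
  have hne : d ≠ [] := MZV.ne_nil_of_mem_starIndices (by simp) d hd
  obtain ⟨d₁, d', rfl⟩ := List.exists_cons_of_ne_nil hne
  simp only [List.headD_cons, List.tail_cons, zero_add]
  rw [MZV.sumStuffle_cons_cons]
  simp only [Function.comp_def, List.append_assoc, List.cons_append]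
  abel

/-- **The first group, unrolled along the suffix** (entries of `suf` positive). [folklore] -/
theorem firstSum_unroll (j : ℕ) : ∀ (suf pre : List ℕ) (b : ℕ), (∀ a ∈ suf, 1 ≤ a) →
    ((starIndices (List.replicate (j + 1) 1)).map fun d =>
        sumStuffle (fun v => Z (pre ++ (b + 1) :: v)) suf d).sum =
      ((starIndices (List.replicate (j + 1) 1)).map fun c =>
          sumStuffle (fun v => Z ((pre ++ [b + 1]) ++ (0 + c.headD 0) :: v)) suf c.tail).sum +
        ∑ i ∈ Finset.range suf.length,
          (((starIndices (List.replicate (j + 1) 1)).map fun c =>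
              sumStuffle (fun v => Z ((pre ++ (b + 1) :: suf.take i) ++ (suf.getD i 0 + c.headD 0) :: v))
                (suf.drop (i + 1)) c.tail).sum +
            ((starIndices (List.replicate (j + 1) 1)).map fun c =>
              sumStuffle (fun v => Z ((pre ++ (b + 1) :: suf.take (i + 1)) ++ (0 + c.headD 0) :: v))
                (suf.drop (i + 1)) c.tail).sum)
  | [], pre, b, _ => by
    simp only [List.length_nil, Finset.range_zero, Finset.sum_empty, add_zero,
      MZV.sumStuffle_nil_left, zero_add]
    refine congrArg List.sum (List.map_congr_left fun d hd => ?_)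
    have hne : d ≠ [] := MZV.ne_nil_of_mem_starIndices (by simp) d hd
    obtain ⟨d₁, d', rfl⟩ := List.exists_cons_of_ne_nil hne
    simp
  | a :: suf, pre, b, hsuf => by
    obtain ⟨a, rfl⟩ : ∃ a', a = a' + 1 := ⟨a - 1, by have := hsuf a (by simp); omega⟩
    have hsuf' : ∀ x ∈ suf, 1 ≤ x := fun x hx => hsuf x (by simp [hx])
    rw [firstSum_cons, firstSum_unroll j suf (pre ++ [b + 1]) a hsuf', List.length_cons,
      Finset.sum_range_succ']
    simp only [List.take_zero, List.take_succ_cons, List.getD_cons_zero, List.getD_cons_succ,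
      List.drop_succ_cons, List.drop_zero, zero_add, List.append_assoc,
      List.cons_append, List.nil_append]
    abel

/-! ### The raised and inserted indices read back -/

section Lists

variable (w : List ℕ) {i : ℕ}

/-- `(raise_i w).take i = w.take i`. [folklore] -/
theorem take_raise (hi : i < w.length) :
    (w.take i ++ [w.getD i 0 + 1] ++ w.drop (i + 1)).take i = w.take i := by
  rw [List.append_assoc, List.take_append_of_le_length (by simp; omega), List.take_take]
  simp

/-- `(raise_i w)_i = w_i + 1`. [folklore] -/
theorem getD_raise (hi : i < w.length) :
    (w.take i ++ [w.getD i 0 + 1] ++ w.drop (i + 1)).getD i 0 = w.getD i 0 + 1 := by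
  have hl : (w.take i).length = i := by simp; omega
  rw [List.append_assoc, List.getD_eq_getElem?_getD, List.getElem?_append_right (by omega), hl,
    Nat.sub_self]
  simp

/-- `(raise_i w).drop (i+1) = w.drop (i+1)`. [folklore] -/
theorem drop_raise (hi : i < w.length) :
    (w.take i ++ [w.getD i 0 + 1] ++ w.drop (i + 1)).drop (i + 1) = w.drop (i + 1) := by
  have hl : (w.take i ++ [w.getD i 0 + 1]).length = i + 1 := by simp; omega
  rw [List.drop_append_of_le_length (by omega), List.drop_eq_nil_of_le (by omega)]
  simp

/-- `(ins_i w).take (i+1) = w.take (i+1)`. [folklore] -/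
theorem take_ins (hi : i < w.length) :
    (w.take (i + 1) ++ [1] ++ w.drop (i + 1)).take (i + 1) = w.take (i + 1) := by
  rw [List.append_assoc, List.take_append_of_le_length (by simp; omega), List.take_take]
  simp

/-- `(ins_i w)_{i+1} = 1`. [folklore] -/
theorem getD_ins (hi : i < w.length) :
    (w.take (i + 1) ++ [1] ++ w.drop (i + 1)).getD (i + 1) 0 = 1 := by
  have hl : (w.take (i + 1)).length = i + 1 := by simp; omega
  rw [List.append_assoc, List.getD_eq_getElem?_getD, List.getElem?_append_right (by omega), hl,
    Nat.sub_self]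
  simp

/-- `(ins_i w).drop (i+2) = w.drop (i+1)`. [folklore] -/
theorem drop_ins (hi : i < w.length) :
    (w.take (i + 1) ++ [1] ++ w.drop (i + 1)).drop (i + 1 + 1) = w.drop (i + 1) := by
  have hl : (w.take (i + 1) ++ [1]).length = i + 1 + 1 := by simp; omega
  rw [List.drop_append_of_le_length (by omega), List.drop_eq_nil_of_le (by omega)]
  simp

end Lists

/-! ### The recursion in the form used by the rider induction -/

/-- **The star–stuffle recursion** (`G_{j+1}(w, m) = Σ_{m ≤ i < k} (G_j(raise_i w, i) + G_j(ins_i w, i+1))`,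
everything read off `w`): for an index `w` with positive entries and a block `m < k`,
`Σ_{c ∈ (1^{j+2})⋆} Σ_{v ∈ w_{>m} ∗ c.tail} Z(w_{<m} ++ (w_m − 1 + c₁) :: v)
 = Σ_{m ≤ i < k} [Σ_{c ∈ (1^{j+1})⋆} Σ_{v ∈ w_{>i} ∗ c.tail} Z(w_{<i} ++ (w_i + c₁) :: v)
              + Σ_{c ∈ (1^{j+1})⋆} Σ_{v ∈ w_{>i} ∗ c.tail} Z(w_{≤i} ++ c₁ :: v)]`.
[cite: KanekoYamamoto2018, Thm 4.1] -/
theorem star_step_identity (j : ℕ) (w : List ℕ) (hw : ∀ a ∈ w, 1 ≤ a) {m : ℕ} (hm : m < w.length) :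
    ((starIndices (List.replicate (j + 2) 1)).map fun c =>
        sumStuffle (fun v => Z (w.take m ++ (w.getD m 0 - 1 + c.headD 0) :: v)) (w.drop (m + 1)) c.tail).sum =
      ∑ i ∈ Finset.Ico m w.length,
        (((starIndices (List.replicate (j + 1) 1)).map fun c =>
            sumStuffle (fun v => Z (w.take i ++ (w.getD i 0 + c.headD 0) :: v)) (w.drop (i + 1)) c.tail).sum +
          ((starIndices (List.replicate (j + 1) 1)).map fun c =>
            sumStuffle (fun v => Z (w.take (i + 1) ++ (0 + c.headD 0) :: v)) (w.drop (i + 1)) c.tail).sum) := by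
  -- write `w = pre ++ (b+1) :: suf`, `m = |pre|`
  obtain ⟨pre, c, suf, rfl, hlen⟩ : ∃ pre c suf, w = pre ++ c :: suf ∧ pre.length = m :=
    ⟨w.take m, w[m], w.drop (m + 1), by rw [← List.drop_eq_getElem_cons hm, List.take_append_drop],
      by simp; omega⟩
  subst hlen
  obtain ⟨b, rfl⟩ : ∃ b, c = b + 1 := ⟨c - 1, by have := hw c (by simp); omega⟩
  have hsuf : ∀ a ∈ suf, 1 ≤ a := fun a ha => hw a (by simp [ha])
  -- reads of `pre ++ (b+1) :: suf`
  have rtake : ∀ t, (pre ++ (b + 1) :: suf).take (pre.length + t) = pre ++ ((b + 1) :: suf).take t := by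
    intro t; rw [List.take_append]; simp
  have rdrop : ∀ t, (pre ++ (b + 1) :: suf).drop (pre.length + t) = ((b + 1) :: suf).drop t := by
    intro t; rw [List.drop_append]; simp
  have rget : ∀ t, (pre ++ (b + 1) :: suf).getD (pre.length + t) 0 = ((b + 1) :: suf).getD t 0 := by
    intro t
    rw [List.getD_eq_getElem?_getD, List.getD_eq_getElem?_getD, List.getElem?_append_right (by omega),
      Nat.add_sub_cancel_left]
  have e1 : (pre ++ (b + 1) :: suf).take pre.length = pre := by
    have h := rtake 0; rwa [Nat.add_zero, List.take_zero, List.append_nil] at h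
  have e2 : (pre ++ (b + 1) :: suf).getD pre.length 0 = b + 1 := by
    have h := rget 0; rwa [Nat.add_zero, List.getD_cons_zero] at h
  have e3 : (pre ++ (b + 1) :: suf).drop (pre.length + 1) = suf := by
    have h := rdrop 1; rwa [List.drop_succ_cons, List.drop_zero] at h
  rw [e1, e2, e3, Nat.add_sub_cancel, starSum_succ, firstSum_unroll Z j suf pre b hsuf]
  -- the right-hand side, block by block
  have hlen : (pre ++ (b + 1) :: suf).length = pre.length + (suf.length + 1) := by simp
  rw [hlen, Finset.sum_Ico_eq_sum_range, Nat.add_sub_cancel_left, Finset.sum_range_succ']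
  have ht : ∀ t ∈ Finset.range suf.length,
      (((starIndices (List.replicate (j + 1) 1)).map fun c =>
          sumStuffle (fun v => Z ((pre ++ (b + 1) :: suf).take (pre.length + (t + 1)) ++
            ((pre ++ (b + 1) :: suf).getD (pre.length + (t + 1)) 0 + c.headD 0) :: v))
            ((pre ++ (b + 1) :: suf).drop (pre.length + (t + 1) + 1)) c.tail).sum +
        ((starIndices (List.replicate (j + 1) 1)).map fun c =>
          sumStuffle (fun v => Z ((pre ++ (b + 1) :: suf).take (pre.length + (t + 1) + 1) ++
            (0 + c.headD 0) :: v))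
            ((pre ++ (b + 1) :: suf).drop (pre.length + (t + 1) + 1)) c.tail).sum) =
      (((starIndices (List.replicate (j + 1) 1)).map fun c =>
          sumStuffle (fun v => Z ((pre ++ (b + 1) :: suf.take t) ++ (suf.getD t 0 + c.headD 0) :: v))
            (suf.drop (t + 1)) c.tail).sum +
        ((starIndices (List.replicate (j + 1) 1)).map fun c =>
          sumStuffle (fun v => Z ((pre ++ (b + 1) :: suf.take (t + 1)) ++ (0 + c.headD 0) :: v))
            (suf.drop (t + 1)) c.tail).sum) := by
    intro t _
    rw [add_assoc pre.length (t + 1) 1, rtake, rtake, rget, rdrop]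
    simp only [List.take_succ_cons, List.getD_cons_succ, List.drop_succ_cons]
  rw [Finset.sum_congr rfl ht]
  have f1 : (pre ++ (b + 1) :: suf).take (pre.length + 0) = pre := by
    have h := rtake 0; rwa [List.take_zero, List.append_nil] at h
  have f2 : (pre ++ (b + 1) :: suf).getD (pre.length + 0) 0 = b + 1 := by
    have h := rget 0; rwa [List.getD_cons_zero] at h
  have f3 : (pre ++ (b + 1) :: suf).drop (pre.length + 0 + 1) = suf := by
    have h := rdrop (0 + 1); rwa [← add_assoc, List.drop_succ_cons, List.drop_zero] at h
  have f4 : (pre ++ (b + 1) :: suf).take (pre.length + 0 + 1) = pre ++ [b + 1] := by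
    have h := rtake (0 + 1); rwa [← add_assoc, List.take_succ_cons, List.take_zero] at h
  rw [f1, f2, f3, f4]
  abel

end Summit.KontsevichZagierPeriods.FurushoPentagon.DoubleShuffleInKZ
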